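import Summits.ResolutionOfSingularities.ResolutionOfSingularities.Theorems.ValuativeTorsorToLurelFfiniteTransport
import Mathlib.RingTheory.TensorProduct.Maps

/-!
# `Valuative.TorsorToLurel`: the centre pulled back to the tensor product

Route `ResolutionOfSingularities/Valuative`, support item `TorsorToLurel`
(stmt-ResolutionOfSingularities-10968), line `Sketch` (perfect-closure descent).
Helper file (commutative algebra only).

A chart `B ⊆ K` over `k` is compared with the compositum `T = k'·ι(B) ⊆ K'` of its image under a
field embedding `ι : K → K'` with the image of `g : k' → K'`; `O'` is a valuation ring of `K'`
containing `T`. If the multiplication map `φ : B ⊗ₖ k' → K'`, `b ⊗ c ↦ ι b * g c`, is injective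
with image `T`, and `T` localised at the centre `𝔪_{O'} ∩ T` is a regular local ring, then the
abstract tensor product `B ⊗ₖ k'` localised at the pulled-back prime `𝔔 = φ⁻¹(𝔪_{O'})` is regular
(the two localisations are isomorphic along `φ`), and `𝔔 ∩ B` is the centre `𝔪_{O' ∩ K} ∩ B` of
the restricted valuation ring on `B` (`stub_ttlTensorCentre`).
-/

noncomputable section

set_option linter.dupNamespace false -- mandated namespace of this single-conjunct summit

open IsLocalRing
open scoped TensorProduct
open Literature.AlgebraicGeometry.Resolution

namespace Summit.ResolutionOfSingularities.ResolutionOfSingularities.Theorems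

/-- **The centre pulled back to the tensor product.** Let `ι : K →ₐ[k] K'` and `g : k' →ₐ[k] K'`
be `k`-algebra maps of fields, `O'` a valuation ring of `K'`, `B ⊆ O'.comap ι` a `k`-subalgebra
of `K`, and suppose the multiplication map `φ : B ⊗ₖ k' → K'` is injective with image the subring
`T ⊆ O'`. If `T` localised at the centre `𝔪_{O'} ∩ T` is a regular local ring, then there is a
prime `𝔔` of `B ⊗ₖ k'` (namely `φ⁻¹(𝔪_{O'})`) lying over the centre `𝔪_{O'.comap ι} ∩ B` of `B`
such that `(B ⊗ₖ k')_𝔔` is a regular local ring. -/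
theorem stub_ttlTensorCentre (k K K' k' : Type) [Field k] [Field K] [Field K'] [Field k']
    [Algebra k K] [Algebra k K'] [Algebra k k'] (ι : K →ₐ[k] K') (g : k' →ₐ[k] K')
    (O' : ValuationSubring K') (B : Subalgebra k K)
    (h₀ : B.toSubring ≤ (O'.comap (ι : K →+* K')).toSubring)
    (hinj : Function.Injective (Algebra.TensorProduct.productMap (ι.comp B.val) g))
    (T : Subring K') (hT : (Algebra.TensorProduct.productMap (ι.comp B.val) g).range.toSubring = T)
    (hTO : T ≤ O'.toSubring)
    (hreg : IsRegularLocalRing (Localization.AtPrime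
      (Ideal.comap (Subring.inclusion hTO) (maximalIdeal O')))) :
    ∃ (𝔔 : Ideal (B ⊗[k] k')) (_ : 𝔔.IsPrime),
      𝔔.comap (algebraMap B (B ⊗[k] k')) =
        Ideal.comap (Subring.inclusion h₀) (maximalIdeal (O'.comap (ι : K →+* K'))) ∧
      IsRegularLocalRing (Localization.AtPrime 𝔔) := by
  classical
  set φ := Algebra.TensorProduct.productMap (ι.comp B.val) g with hφ
  -- the ring isomorphism `B ⊗ₖ k' ≃ T` induced by the injective map `φ` with image `T`
  let eT : B ⊗[k] k' ≃+* T :=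
    (AlgEquiv.ofInjective φ hinj).toRingEquiv.trans (RingEquiv.subringCongr hT)
  have heT : ∀ z : B ⊗[k] k', ((eT z : T) : K') = φ z := fun _ => rfl
  set P : Ideal T := Ideal.comap (Subring.inclusion hTO) (maximalIdeal ↥O') with hP
  haveI hPp : P.IsPrime := Ideal.comap_isPrime _ _
  set 𝔔 : Ideal (B ⊗[k] k') := P.comap eT.toRingHom with h𝔔
  haveI h𝔔p : 𝔔.IsPrime := Ideal.comap_isPrime _ _
  refine ⟨𝔔, h𝔔p, ?_, ?_⟩
  · -- `𝔔 ∩ B` is the centre of `O'.comap ι` on `B`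
    ext b
    simp only [h𝔔, hP, Ideal.mem_comap, RingEquiv.toRingHom_eq_coe, RingHom.coe_coe]
    rw [ValuationSubring.valuation_lt_one_iff, ValuationSubring.valuation_lt_one_iff]
    change O'.valuation ((eT (algebraMap B (B ⊗[k] k') b) : T) : K') < 1 ↔
      (O'.comap (ι : K →+* K')).valuation (b : K) < 1
    rw [heT, Algebra.TensorProduct.algebraMap_apply, Algebra.algebraMap_self_apply, hφ,
      Algebra.TensorProduct.productMap_left_apply, valuation_comap_lt_one_iff]
    rfl
  · -- `(B ⊗ₖ k')_𝔔 ≃ T_P` along `eT`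
    have hmap : Submonoid.map eT.toRingHom.toMonoidHom 𝔔.primeCompl = P.primeCompl := by
      ext y
      constructor
      · rintro ⟨x, hx, rfl⟩
        simpa [Ideal.primeCompl, h𝔔] using hx
      · intro hy
        refine ⟨eT.symm y, ?_, by simp⟩
        simpa [Ideal.primeCompl, h𝔔] using hy
    let e : Localization.AtPrime 𝔔 ≃+* Localization.AtPrime P :=
      IsLocalization.ringEquivOfRingEquiv (Localization.AtPrime 𝔔) (Localization.AtPrime P)
        eT hmap
    exact IsRegularLocalRing.of_ringEquiv e.symm

end Summit.ResolutionOfSingularities.ResolutionOfSingularities.Theorems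

end
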